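import Literature.NumberTheory.EllipticCurves.HeckeOnManinSymbols
import HarnessLib

/-!
# Hecke operators on M-symbols: the boundary map (`δ ∘ 𝔗_ξ = σ₁(n) δ`)

The second application of the abstract Popa–Zagier compatibility theorem
`PopaZagier.finsum_smul_msym_eq`: with the **boundary symbol family**
`ψ^∂_y(v) = e_{[k_y v]} ∈ ℚ^{cusps(Γ₀(N))}` (the class of the cusp `k_y v ∈ ℙ¹(ℚ)`), whose M-symbol
is the boundary vector `δ(y) = e_{[k_y ∞]} - e_{[k_y 0]}` of `ModularSymbolsManin` (`msym_psiBdry`),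
one gets for `ξ` finitely supported on determinant `n`, `(n, N) = 1`, with property (A):
`∑_M ξ(M) δ(y · adj M) = 2 ∑_{C ∈ R_n} (e_{[C k_y ∞]} - e_{[C k_y 0]})`.  For **squarefree** `N` the
Hermite matrices `C ∈ R_n` do not move cusp classes (`cuspCls_mulVec_of_mem_hermiteReps`: the class
of `a/c` is determined by `gcd(c, N)`, Diamond–Shurman §3.8), so the right-hand side is
`2 σ₁(n) δ(y)` (`finsum_smul_bdryVec_eq`).  This is the boundary part of Popa's proof of the trace
formula (Popa 2018, §2 and §4: the Hecke operators act on `C(M) ≅ ℚ^{cusps}` through the cusps,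
with all eigenvalues `σ₁(n)` when `(n, N) = 1` and `N` is squarefree).

## References
* [PopaZagier2017] A. Popa, D. Zagier, Proc. AMS 145 (2017), §5.
* [Popa2014] A. Popa, Res. Math. Sci. 5 (2018), §2, §4.
* [DiamondShurman2005] F. Diamond, J. Shurman, *A First Course in Modular Forms*, §3.8.
-/

noncomputable section

open scoped MatrixGroups ModularForm Classical
open CongruenceSubgroup ModularGroup
open scoped Matrix
open Literature.NumberTheory.Automorphic.PopaZagier

namespace Literature.NumberTheory.EllipticCurves.ModularForms

open ParabolicCount (sec coe_sec sec_smul_inv_mul_mem)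

variable (N : ℕ) [NeZero N]

/-! ### The cusp class of an integer column -/

/-- **The cusp class of a nonzero integer column** `v = c · g e₀` (`c ≠ 0`, `g ∈ SL₂(ℤ)`):
`[g ∞] ∈ Γ₀(N)\ℙ¹(ℚ)` (the class of the cusp `v₀/v₁`); junk (`[∞]`) at `v = 0`. [folklore] -/
def cuspCls (v : Fin 2 → ℤ) : CuspOrbits (Gamma0 N : Subgroup (GL (Fin 2) ℝ)) :=
  if hv : v ≠ 0 then cuspOrbitOf N (exists_smul_coe_mulVec_e0_eq hv).choose_spec.choose
  else cuspOrbitOf N 1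

variable {N}

omit [NeZero N] in
/-- Primitive columns with proportional nonzero multiples agree up to sign. [folklore] -/
theorem coe_mulVec_e0_eq_of_smul_eq {c c' : ℤ} (hc : c ≠ 0) {g g' : SL(2, ℤ)}
    (h : c' • ((g' : Matrix (Fin 2) (Fin 2) ℤ) *ᵥ e0) = c • ((g : Matrix (Fin 2) (Fin 2) ℤ) *ᵥ e0)) :
    ∃ ε : ℤ, (ε = 1 ∨ ε = -1) ∧ g' 0 0 = ε * g 0 0 ∧ g' 1 0 = ε * g 1 0 := by
  have h0 : c' * g' 0 0 = c * g 0 0 := by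
    have := congrFun h 0; simpa [mulVec_two, e0] using this
  have h1 : c' * g' 1 0 = c * g 1 0 := by
    have := congrFun h 1; simpa [mulVec_two, e0] using this
  have hg : Int.gcd (g 0 0) (g 1 0) = 1 := Int.isCoprime_iff_gcd_eq_one.mp (isCoprime_apply g)
  have hg' : Int.gcd (g' 0 0) (g' 1 0) = 1 := Int.isCoprime_iff_gcd_eq_one.mp (isCoprime_apply g')
  have habs : c'.natAbs = c.natAbs := by
    have := congrArg₂ Int.gcd h0 h1
    rw [Int.gcd_mul_left, Int.gcd_mul_left, hg, hg', mul_one, mul_one] at this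
    exact this
  rcases Int.natAbs_eq_natAbs_iff.mp habs with rfl | rfl
  · exact ⟨1, Or.inl rfl, by rw [one_mul]; exact mul_left_cancel₀ hc h0,
      by rw [one_mul]; exact mul_left_cancel₀ hc h1⟩
  · refine ⟨-1, Or.inr rfl, ?_, ?_⟩
    · have : -c * g' 0 0 = -c * (-1 * g 0 0) := by linear_combination h0
      exact mul_left_cancel₀ (neg_ne_zero.mpr hc) this
    · have : -c * g' 1 0 = -c * (-1 * g 1 0) := by linear_combination h1
      exact mul_left_cancel₀ (neg_ne_zero.mpr hc) this

/-- **`cuspCls` is well defined**: `cuspCls (c · g e₀) = [g ∞]` for `c ≠ 0`. [folklore] -/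
theorem cuspCls_smul_coe_mulVec_e0 {c : ℤ} (hc : c ≠ 0) (g : SL(2, ℤ)) :
    cuspCls N (c • ((g : Matrix (Fin 2) (Fin 2) ℤ) *ᵥ e0)) = cuspOrbitOf N g := by
  have hv : c • ((g : Matrix (Fin 2) (Fin 2) ℤ) *ᵥ e0) ≠ 0 := by
    rw [smul_ne_zero_iff]; exact ⟨hc, mulVec_ne_zero_of_det_ne_zero (by simp) e0_ne_zero⟩
  rw [cuspCls, dif_pos hv]
  set hex := exists_smul_coe_mulVec_e0_eq hv
  obtain ⟨-, hspec⟩ := hex.choose_spec.choose_spec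
  obtain ⟨ε, hε, h0, h1⟩ := coe_mulVec_e0_eq_of_smul_eq hc hspec
  exact cuspOrbitOf_eq_of_apply_eq ε hε h0 h1

/-- `cuspCls (g e₀) = [g ∞]`. [folklore] -/
theorem cuspCls_coe_mulVec_e0 (g : SL(2, ℤ)) :
    cuspCls N ((g : Matrix (Fin 2) (Fin 2) ℤ) *ᵥ e0) = cuspOrbitOf N g := by
  rw [← one_smul ℤ ((g : Matrix (Fin 2) (Fin 2) ℤ) *ᵥ e0), cuspCls_smul_coe_mulVec_e0 one_ne_zero]

/-- Homogeneity: `cuspCls (c v) = cuspCls v` for `c ≠ 0`. [folklore] -/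
theorem cuspCls_smul {c : ℤ} (hc : c ≠ 0) (v : Fin 2 → ℤ) : cuspCls N (c • v) = cuspCls N v := by
  by_cases hv : v = 0
  · rw [hv, smul_zero]
  · obtain ⟨c', g, hc', rfl⟩ := exists_smul_coe_mulVec_e0_eq hv
    rw [smul_smul, cuspCls_smul_coe_mulVec_e0 (mul_ne_zero hc hc'), cuspCls_smul_coe_mulVec_e0 hc']

/-- `cuspCls (-v) = cuspCls v`. [folklore] -/
theorem cuspCls_neg (v : Fin 2 → ℤ) : cuspCls N (-v) = cuspCls N v := by
  rw [show -v = (-1 : ℤ) • v by simp, cuspCls_smul (by norm_num)]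

/-- `Γ₀(N)`-invariance: `cuspCls (δ v) = cuspCls v` for `δ ∈ Γ₀(N)`. [folklore] -/
theorem cuspCls_gamma0_mulVec {δ : SL(2, ℤ)} (hδ : δ ∈ Gamma0 N) (v : Fin 2 → ℤ) :
    cuspCls N ((δ : Matrix (Fin 2) (Fin 2) ℤ) *ᵥ v) = cuspCls N v := by
  by_cases hv : v = 0
  · rw [hv, Matrix.mulVec_zero]
  · obtain ⟨c, g, hc, rfl⟩ := exists_smul_coe_mulVec_e0_eq hv
    rw [Matrix.mulVec_smul, Matrix.mulVec_mulVec, ← Matrix.SpecialLinearGroup.coe_mul,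
      cuspCls_smul_coe_mulVec_e0 hc, cuspCls_smul_coe_mulVec_e0 hc, cuspOrbitOf_mul_of_mem hδ]

/-! ### Squarefree level: Hermite matrices preserve cusp classes -/

/-- For squarefree `N`, the cusp orbit `[g ∞]` is determined by `gcd(c, N)`, `g = (a b; c d)`
(Diamond–Shurman §3.8: the invariant `(d, unit mod gcd(d, N/d))` has trivial second component).
[cite: DiamondShurman2005, §3.8] -/
theorem cuspOrbitOf_eq_of_cuspDivisor_eq (hN : Squarefree N) {g g' : SL(2, ℤ)}
    (h : cuspDivisor N g = cuspDivisor N g') : cuspOrbitOf N g = cuspOrbitOf N g' := by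
  rw [cuspOrbitOf_eq_iff_cuspInv_eq, cuspInv, cuspInv, CuspIndex.mk_eq_mk_iff]
  refine ⟨h, ?_⟩
  have h1 : Nat.gcd (cuspDivisor N g) (N / cuspDivisor N g) = 1 := by
    apply Nat.Coprime.gcd_eq_one
    apply Nat.coprime_of_squarefree_mul
    rw [Nat.mul_div_cancel' (cuspDivisor_dvd N g)]
    exact hN
  haveI : Subsingleton (ZMod (Nat.gcd (cuspDivisor N g) (N / cuspDivisor N g))) := by
    rw [h1]; infer_instance
  exact Subsingleton.elim _ _

omit [NeZero N] in
/-- `gcd(c a, N) = gcd(a, N)` for `c` prime to `N` (integers). [folklore] -/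
theorem int_gcd_mul_left_of_coprime {c : ℤ} (hc : Nat.Coprime c.natAbs N) (a : ℤ) :
    Int.gcd (c * a) N = Int.gcd a N := by
  rw [Int.gcd, Int.gcd, Int.natAbs_mul]
  exact Nat.Coprime.gcd_mul_left_cancel a.natAbs hc

/-- **Hermite matrices do not move cusp classes at squarefree level**: for `N` squarefree,
`(n, N) = 1`, `C ∈ R_n` and a primitive column `g e₀`, `cuspCls (C g e₀) = cuspCls (g e₀)`
(`C = (a b; 0 d)`: the bottom entry is multiplied by `d ∣ n` and the content of `C g e₀` divides
`n`, both prime to `N`, so `gcd(·, N)` of the bottom entry is unchanged). [cite: DiamondShurman2005, §3.8] -/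
theorem cuspCls_mulVec_of_mem_hermiteReps (hN : Squarefree N) {n : ℕ} (hn : 0 < n) (hnN : n.Coprime N)
    {C : Matrix (Fin 2) (Fin 2) ℤ} (hC : C ∈ hermiteReps (n : ℤ)) (g : SL(2, ℤ)) :
    cuspCls N (C *ᵥ ((g : Matrix (Fin 2) (Fin 2) ℤ) *ᵥ e0)) =
      cuspCls N ((g : Matrix (Fin 2) (Fin 2) ℤ) *ᵥ e0) := by
  have hn' : (0 : ℤ) < n := by exact_mod_cast hn
  obtain ⟨hc0, ha, -, -, hdet⟩ := (mem_hermiteReps hn' C).mp hC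
  have hCv : C *ᵥ ((g : Matrix (Fin 2) (Fin 2) ℤ) *ᵥ e0) ≠ 0 :=
    mulVec_ne_zero_of_det_ne_zero (by rw [hdet]; exact hn'.ne')
      (mulVec_ne_zero_of_det_ne_zero (by simp) e0_ne_zero)
  obtain ⟨c', g', hc', hg'⟩ := exists_smul_coe_mulVec_e0_eq hCv
  rw [← hg', cuspCls_smul_coe_mulVec_e0 hc', cuspCls_coe_mulVec_e0]
  apply cuspOrbitOf_eq_of_cuspDivisor_eq hN
  -- bottom entries: `c' g'₁₀ = d g₁₀`, `d = C 1 1`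
  have hbot : c' * g' 1 0 = C 1 1 * g 1 0 := by
    have := congrFun hg' 1
    simpa [mulVec_two, e0, hc0] using this
  -- the content `c'` divides `n`
  have hc'n : c' ∣ (n : ℤ) := by
    have h2 : c' • (Matrix.adjugate C *ᵥ ((g' : Matrix (Fin 2) (Fin 2) ℤ) *ᵥ e0)) =
        (n : ℤ) • ((g : Matrix (Fin 2) (Fin 2) ℤ) *ᵥ e0) := by
      rw [← Matrix.mulVec_smul, hg', Matrix.mulVec_mulVec, Matrix.adjugate_mul, hdet, Matrix.smul_mulVec,
        Matrix.one_mulVec]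
    have h20 : c' ∣ (n : ℤ) * g 0 0 := by
      have := congrFun h2 0
      simp only [Pi.smul_apply, smul_eq_mul] at this
      refine ⟨(Matrix.adjugate C *ᵥ ((g' : Matrix (Fin 2) (Fin 2) ℤ) *ᵥ e0)) 0, ?_⟩
      rw [this]; simp [mulVec_two, e0]
    have h21 : c' ∣ (n : ℤ) * g 1 0 := by
      have := congrFun h2 1
      simp only [Pi.smul_apply, smul_eq_mul] at this
      refine ⟨(Matrix.adjugate C *ᵥ ((g' : Matrix (Fin 2) (Fin 2) ℤ) *ᵥ e0)) 1, ?_⟩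
      rw [this]; simp [mulVec_two, e0]
    obtain ⟨x, y, hxy⟩ := isCoprime_apply g
    have : (n : ℤ) = x * ((n : ℤ) * g 0 0) + y * ((n : ℤ) * g 1 0) := by linear_combination -(n : ℤ) * hxy
    rw [this]
    exact dvd_add (dvd_mul_of_dvd_right h20 _) (dvd_mul_of_dvd_right h21 _)
  have hc'N : Nat.Coprime c'.natAbs N :=
    Nat.Coprime.coprime_dvd_left (Int.natAbs_dvd_natAbs.mpr hc'n |>.trans (by simp)) hnN
  have hdN : Nat.Coprime (C 1 1).natAbs N := by
    have hd : C 1 1 ∣ (n : ℤ) := by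
      rw [← hdet, Matrix.det_fin_two, hc0, mul_zero, sub_zero]; exact dvd_mul_left _ _
    exact Nat.Coprime.coprime_dvd_left (Int.natAbs_dvd_natAbs.mpr hd |>.trans (by simp)) hnN
  rw [cuspDivisor, cuspDivisor, ← int_gcd_mul_left_of_coprime hc'N (g' 1 0), hbot,
    int_gcd_mul_left_of_coprime hdN]

/-! ### The boundary symbol family -/

variable (N) in
/-- **The boundary symbol family** `ψ^∂_y(v) = e_{[k_y v]} ∈ ℚ^{cusps}`, `k_y = (sec y)⁻¹`.
[cite: Popa2014, §2] -/
def psiBdry (y : Gamma0Coset N) (v : Fin 2 → ℤ) : CuspOrbits (Gamma0 N : Subgroup (GL (Fin 2) ℝ)) → ℚ :=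
  Pi.single (cuspCls N ((((sec y)⁻¹ : SL(2, ℤ)) : Matrix (Fin 2) (Fin 2) ℤ) *ᵥ v)) 1

/-- `ψ^∂` at the coset `h⁻¹Γ₀(N)` is `e_{[h v]}`. [folklore] -/
theorem psiBdry_coe_inv (h : SL(2, ℤ)) (v : Fin 2 → ℤ) :
    psiBdry N ((h⁻¹ : SL(2, ℤ)) : Gamma0Coset N) v =
      Pi.single (cuspCls N ((h : Matrix (Fin 2) (Fin 2) ℤ) *ᵥ v)) 1 := by
  -- `sec (h⁻¹ Γ₀) = h⁻¹ δ'` with `δ' ∈ Γ₀(N)`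
  set δ' : SL(2, ℤ) := h * sec (((h⁻¹ : SL(2, ℤ)) : Gamma0Coset N)) with hδ'
  have hδ'mem : δ' ∈ Gamma0 N := by
    have := (QuotientGroup.eq (s := Gamma0 N)).mp
      (coe_sec (((h⁻¹ : SL(2, ℤ)) : Gamma0Coset N))).symm
    simpa [hδ'] using this
  have hinv : (sec (((h⁻¹ : SL(2, ℤ)) : Gamma0Coset N)))⁻¹ = δ'⁻¹ * h := by
    rw [hδ', _root_.mul_inv_rev, inv_mul_cancel_right]
  unfold psiBdry
  rw [hinv, Matrix.SpecialLinearGroup.coe_mul, ← Matrix.mulVec_mulVec,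
    cuspCls_gamma0_mulVec (inv_mem hδ'mem)]

/-- **`ψ^∂` is a symbol family** for the action `actP` (homogeneous, and exactly `SL₂(ℤ)`-equivariant
since `Γ₀(N)` does not move cusp classes). [cite: Popa2014, §2] -/
theorem symbolFamily_psiBdry : SymbolFamily (actP N) (psiBdry N) where
  smul y c v hc := by
    unfold psiBdry
    rw [Matrix.mulVec_smul, cuspCls_smul hc]
  equivar y γ hγ v w _ _ := by
    set γ' : SL(2, ℤ) := ⟨γ, hγ⟩ with hγ'
    have hact : actP N y γ = γ'⁻¹ • y := actP_coe N y γ'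
    set δ : SL(2, ℤ) := (sec (γ'⁻¹ • y))⁻¹ * γ'⁻¹ * sec y with hδ
    have hδmem : δ ∈ Gamma0 N := sec_smul_inv_mul_mem γ'⁻¹ y
    have hk : (sec (γ'⁻¹ • y))⁻¹ = δ * (sec y)⁻¹ * γ' := by rw [hδ]; group
    have key : ∀ u : Fin 2 → ℤ, psiBdry N (actP N y γ) u = psiBdry N y (γ *ᵥ u) := by
      intro u
      unfold psiBdry
      rw [hact, hk, Matrix.SpecialLinearGroup.coe_mul, Matrix.SpecialLinearGroup.coe_mul,
        Matrix.mul_assoc, ← Matrix.mulVec_mulVec, cuspCls_gamma0_mulVec hδmem, ← Matrix.mulVec_mulVec]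
    rw [key v, key w]

/-- **The M-symbol of `ψ^∂` is the boundary vector**: `ψ^∂_y(e₀) - ψ^∂_y(e₁) = δ(y)`
(`[k_y ∞] - [k_y 0]`). [cite: CremonaAlgorithms1997, §2.2] -/
theorem msym_psiBdry (y : Gamma0Coset N) : msym (psiBdry N) y = bdryVec N y := by
  have hy : cuspInfty N y = cuspOrbitOf N (sec y)⁻¹ := by
    conv_lhs => rw [← coe_sec y]
    rfl
  have hy' : cuspInfty N (S⁻¹ • y) = cuspOrbitOf N ((sec y)⁻¹ * S) := by
    conv_lhs => rw [← coe_sec y, MulAction.Quotient.smul_mk, smul_eq_mul]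
    rw [cuspInfty_mk, _root_.mul_inv_rev, inv_inv]
  rw [bdryVec, hy, hy', msym, psiBdry, psiBdry, cuspCls_coe_mulVec_e0, ← cuspCls_coe_mulVec_e0 ((sec y)⁻¹ * S),
    Matrix.SpecialLinearGroup.coe_mul, ← Matrix.mulVec_mulVec, ModularGroup.coe_S]
  congr 4

/-- **The `C'`-term of the boundary sum**: if `h C' = C k_q S⁻¹` (`C, C' ∈ R_n`, `(n, N) = 1`), then
`ψ^∂_{(q·adj S)·adj C'}(C' e₁) - ψ^∂_{(q·adj S)·adj C'}(e₀) = e_{[C k_q e₀]} - e_{[C k_q e₁]}`.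
[cite: PopaZagier2017, §5] -/
theorem term_hnf_bdry {n : ℤ} (hn : 0 < n) (hnN : IsUnit ((n : ℤ) : ZMod N)) (q : Gamma0Coset N)
    {C C' : Matrix (Fin 2) (Fin 2) ℤ} (hC : C ∈ hermiteReps n) (hC' : C' ∈ hermiteReps n)
    (h : SL(2, ℤ))
    (hh : (h : Matrix (Fin 2) (Fin 2) ℤ) * C' =
      C * (((sec q)⁻¹ * S⁻¹ : SL(2, ℤ)) : Matrix (Fin 2) (Fin 2) ℤ)) :
    psiBdry N (actP N (actP N q (Matrix.adjugate matS)) (Matrix.adjugate C')) (C' *ᵥ e1) -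
        psiBdry N (actP N (actP N q (Matrix.adjugate matS)) (Matrix.adjugate C')) e0 =
      Pi.single (cuspCls N (C *ᵥ ((((sec q)⁻¹ : SL(2, ℤ)) : Matrix (Fin 2) (Fin 2) ℤ) *ᵥ e0))) 1 -
        Pi.single (cuspCls N (C *ᵥ ((((sec q)⁻¹ : SL(2, ℤ)) : Matrix (Fin 2) (Fin 2) ℤ) *ᵥ e1))) 1 := by
  obtain ⟨-, ha', -, -, -⟩ := (mem_hermiteReps hn C').mp hC'
  rw [actP_actP_eq_coe hn hnN q hC hC' h hh, psiBdry_coe_inv, psiBdry_coe_inv]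
  have hk := coe_S_inv_mulVec
  have h1 : (h : Matrix (Fin 2) (Fin 2) ℤ) *ᵥ (C' *ᵥ e1) =
      C *ᵥ ((((sec q)⁻¹ : SL(2, ℤ)) : Matrix (Fin 2) (Fin 2) ℤ) *ᵥ e0) := by
    rw [Matrix.mulVec_mulVec, hh, ← Matrix.mulVec_mulVec, Matrix.SpecialLinearGroup.coe_mul,
      ← Matrix.mulVec_mulVec, hk.1]
  have h2 : C' 0 0 • ((h : Matrix (Fin 2) (Fin 2) ℤ) *ᵥ e0) =
      -(C *ᵥ ((((sec q)⁻¹ : SL(2, ℤ)) : Matrix (Fin 2) (Fin 2) ℤ) *ᵥ e1)) := by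
    rw [← Matrix.mulVec_smul, ← mulVec_e0_of_mem_hermiteReps hn hC', Matrix.mulVec_mulVec, hh,
      ← Matrix.mulVec_mulVec, Matrix.SpecialLinearGroup.coe_mul, ← Matrix.mulVec_mulVec, hk.2,
      Matrix.mulVec_neg, Matrix.mulVec_neg]
  rw [h1, ← cuspCls_smul ha'.ne' ((h : Matrix (Fin 2) (Fin 2) ℤ) *ᵥ e0), h2, cuspCls_neg]

/-- **Boundary compatibility** (general level): for `ξ` finitely supported on determinant `n`,
`(n, N) = 1`, with property (A) in orbit form,
`∑_M ξ(M) δ(q · adj M) = 2 ∑_{C ∈ R_n} (e_{[C k_q e₀]} - e_{[C k_q e₁]})`.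
[cite: PopaZagier2017, Thm. 1, §5] -/
theorem finsum_smul_bdryVec_eq_sum {n : ℕ} (hn : 0 < n) (hnN : n.Coprime N)
    {ξ : Matrix (Fin 2) (Fin 2) ℤ → ℚ}
    (hfin : (Function.support ξ).Finite) (hdet : ∀ M, ξ M ≠ 0 → M.det = n)
    (hA : ∀ M : Matrix (Fin 2) (Fin 2) ℤ, M.det = n →
      orbT (zeta0 ξ) M = (if M 1 0 = 0 then 1 else 0) - (if M 1 1 = 0 then 1 else 0))
    (q : Gamma0Coset N) :
    ∑ᶠ M, ξ M • bdryVec N (actP N q (Matrix.adjugate M)) =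
      (2 : ℚ) • ∑ C ∈ hermiteReps (n : ℤ),
        ((Pi.single (cuspCls N (C *ᵥ ((((sec q)⁻¹ : SL(2, ℤ)) : Matrix (Fin 2) (Fin 2) ℤ) *ᵥ e0))) 1 :
            CuspOrbits (Gamma0 N : Subgroup (GL (Fin 2) ℝ)) → ℚ) -
          Pi.single (cuspCls N (C *ᵥ ((((sec q)⁻¹ : SL(2, ℤ)) : Matrix (Fin 2) (Fin 2) ℤ) *ᵥ e1))) 1) := by
  have hn' : (0 : ℤ) < n := by exact_mod_cast hn
  have hunit : IsUnit (((n : ℤ) : ℤ) : ZMod N) := by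
    rw [Int.cast_natCast]; exact (ZMod.isUnit_iff_coprime n N).mpr hnN
  have hgood : ∀ M : Matrix (Fin 2) (Fin 2) ℤ, M.det = n → IsUnit ((M.det : ℤ) : ZMod N) :=
    fun M hM => by rw [hM]; exact hunit
  have key := finsum_smul_msym_eq (cosetAction_actP N) symbolFamily_psiBdry hn' hfin hdet hgood hA q
  simp only [msym_psiBdry] at key
  rw [key]
  congr 1
  symm
  obtain ⟨hmaps, hinj, hsurj⟩ := hnfRep_bijOn (N := N) hn' q
  refine Finset.sum_nbij (hnfRep hn' q) (fun C hC => hmaps (Finset.mem_coe.mpr hC)) hinj hsurj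
    fun C hC => ?_
  have hdC := det_of_mem_hermiteReps hn' hC
  obtain ⟨hmem, hh⟩ := hnfRep_spec hn' q hdC
  exact (term_hnf_bdry hn' hunit q hC hmem (hnfSL hn' q C hdC) hh).symm

/-- `#R_n = σ₁(n)`. [folklore] -/
theorem card_hermiteReps {n : ℕ} (hn : 0 < n) : (hermiteReps (n : ℤ)).card = n.divisors.sum id := by
  rw [Finset.card_eq_sum_ones, sum_hermiteReps_eq hn]
  simp only [Finset.sum_const, Finset.card_range, smul_eq_mul, mul_one]
  rw [Nat.sum_divisorsAntidiagonal (fun _ d => d), ← Nat.sum_div_divisors n id]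
  rfl

/-- **`δ ∘ 𝔗_ξ = σ₁(n) δ` at squarefree level**: for `N` squarefree, `(n, N) = 1` and `ξ` as above,
`∑_M ξ(M) δ(q · adj M) = 2 σ₁(n) δ(q)` (the Hermite matrices do not move cusp classes).
[cite: Popa2014, §2] -/
theorem finsum_smul_bdryVec_eq (hN : Squarefree N) {n : ℕ} (hn : 0 < n) (hnN : n.Coprime N)
    {ξ : Matrix (Fin 2) (Fin 2) ℤ → ℚ}
    (hfin : (Function.support ξ).Finite) (hdet : ∀ M, ξ M ≠ 0 → M.det = n)
    (hA : ∀ M : Matrix (Fin 2) (Fin 2) ℤ, M.det = n →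
      orbT (zeta0 ξ) M = (if M 1 0 = 0 then 1 else 0) - (if M 1 1 = 0 then 1 else 0))
    (q : Gamma0Coset N) :
    ∑ᶠ M, ξ M • bdryVec N (actP N q (Matrix.adjugate M)) =
      ((2 * n.divisors.sum id : ℕ) : ℚ) • bdryVec N q := by
  rw [finsum_smul_bdryVec_eq_sum hn hnN hfin hdet hA q]
  have hk : (((sec q)⁻¹ : SL(2, ℤ)) : Matrix (Fin 2) (Fin 2) ℤ) *ᵥ e1 =
      ((((sec q)⁻¹ * S : SL(2, ℤ)) : Matrix (Fin 2) (Fin 2) ℤ) *ᵥ e0) := by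
    rw [Matrix.SpecialLinearGroup.coe_mul, ← Matrix.mulVec_mulVec, ModularGroup.coe_S]
    congr 1
    ext i; fin_cases i <;> simp [mulVec_two, e0, e1]
  have hterm : ∀ C ∈ hermiteReps (n : ℤ),
      ((Pi.single (cuspCls N (C *ᵥ ((((sec q)⁻¹ : SL(2, ℤ)) : Matrix (Fin 2) (Fin 2) ℤ) *ᵥ e0))) 1 :
            CuspOrbits (Gamma0 N : Subgroup (GL (Fin 2) ℝ)) → ℚ) -
          Pi.single (cuspCls N (C *ᵥ ((((sec q)⁻¹ : SL(2, ℤ)) : Matrix (Fin 2) (Fin 2) ℤ) *ᵥ e1))) 1) =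
        bdryVec N q := fun C hC => by
    rw [hk, cuspCls_mulVec_of_mem_hermiteReps hN hn hnN hC, cuspCls_mulVec_of_mem_hermiteReps hN hn hnN hC,
      ← hk, ← msym_psiBdry q, msym, psiBdry, psiBdry]
  rw [Finset.sum_congr rfl hterm, Finset.sum_const, card_hermiteReps hn, ← Nat.cast_smul_eq_nsmul ℚ,
    smul_smul, Nat.cast_mul, Nat.cast_ofNat]

end Literature.NumberTheory.EllipticCurves.ModularForms

end
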